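import Summits.Langlands.Langlands.Theorems.SchurObstructionExit
import Literature.NumberTheory.Automorphic.ReciprocityGLnRankOneProofs
import Literature.NumberTheory.Automorphic.AlgebraicityParityGL
import Literature.NumberTheory.GaloisRepresentations.GaloisRepFrobeniusProofs
import Literature.NumberTheory.GaloisRepresentations.SatakeFamilyOfFramedGaloisRep

/-!
# `TwinRigiditySplitPrelude` — pieces and Galois shadow of the lens-4 g29 node `TwinRigiditySplit`

Part 1 of 3 of the twin-landing of `run/shared/lean/pub/decomp-langlands/decomp-langlands-lens-4/g29/TwinRigiditySplit.lean` (certified as ONE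
602-line file: rc 0 · 0 sorry · standard axioms; cut at `end Shadow` for the 400-line lint).  Contents: §0 the node-local pieces
`CandidateAutomorphy` (AUT, sha12 f13f8e4188e1), `AutomorphicLayerRigidity` (ALR, 00c0d5bd6eb0), the rank family `AutomorphicLayerRigidityAt`
(ec582385ae70) — binder prefixes literal copies of the target `TatePhantomLift.PerfectLayerRigidity` (RIGID, 6f5d782b2b84) — and §1 the Galois
shadow of ALR (uniqueness of extension across a layer without cyclic-prime sub-layers: `character_eq_one_of_trivial_on_layer`,
`conj_of_frobenius_on_layer`, `candidate_unique`, `relAvatar_transfer`, `alr_pointwise_of_avatars`, …; 0 sorry).  The kernel `closes_target :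
AUT → ALR → RIGID`, exactness, the rank-one rung and the host edges are in `TwinRigiditySplit.lean`; the regular-algebraic odd-rank cell in
`TwinRigiditySplitRegular.lean`.  The full mathematical header is reproduced in `TwinRigiditySplit.lean`.
-/

set_option linter.dupNamespace false
set_option linter.unusedVariables false
set_option linter.style.longLine false

namespace Summit.Langlands.Langlands.Theorems.TwinRigiditySplit

open scoped BigOperators Topology Matrix Classical
open Filter Set Function
open Literature.NumberTheory.GaloisRepresentations Literature.NumberTheory.Automorphic
open IsDedekindDomain
open Summit.Langlands.Langlands.Theses
open Summit.Langlands.Langlands.Theses.GaloisHullLift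
open Summit.Langlands.Langlands.Theorems.TatePhantomLift
open scoped NumberField Polynomial

/-! ## §0 The pieces (TARGET = tree `TatePhantomLift.PerfectLayerRigidity`, consumed BY NAME; binder prefixes are literal copies of it) -/

/-- **AUT · DECLARED RESIDUAL · WEAKER (RIGID-implied) · S-implied · (B)-side · IDEA-NEEDED** — candidate automorphy: along a Galois layer
`L/K` without cyclic sub-layers of prime degree, every semisimple `ρ₀ : Γ_K → GL_n(ℚ̄_ℓ)` whose restriction to `Γ_L` is irreducible and a
relative avatar of the L-algebraic cuspidal `π` is a.e. Satake–Frobenius compatible with SOME L-algebraic cuspidal `π'` of `GL_n/K`.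
Why it might fail: it does not if Langlands holds (`aut_of_langlands`); open — automorphy after a non-solvable formal base change, no residual handle. -/
def CandidateAutomorphy : Prop :=
  ∀ (K : Type) [Field K] [NumberField K] (n : ℕ) (hcpt : Literature.NumberTheory.Automorphic.isCompact_glFiniteIntegralLevel n K), 0 < n → ∀ (π : Literature.NumberTheory.Automorphic.CuspidalAutomorphicRepData n K hcpt), π.1.IsLAlgebraic → ∀ (L : Type) [Field L] [NumberField L] [Algebra K L], IsGalois K L → Module.finrank K L ≠ 1 → (¬ ∃ F : IntermediateField K L, F ≠ ⊥ ∧ IsGalois K ↥F ∧ IsCyclic (↥F ≃ₐ[K] ↥F) ∧ (Module.finrank K ↥F).Prime) → ∀ (ℓ : ℕ) [Fact ℓ.Prime] (ι : PadicAlgCl ℓ ≃+* ℂ) (ρ₀ : Literature.NumberTheory.GaloisRepresentations.FramedGaloisRep K (PadicAlgCl ℓ) n), ρ₀.toGaloisRep.IsSemisimple → (ρ₀.restrictField L).IsIrreducible → (∀ᶠ w : IsDedekindDomain.HeightOneSpectrum (NumberField.RingOfIntegers L) in cofinite, ∀ (v : IsDedekindDomain.HeightOneSpectrum (NumberField.RingOfIntegers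 K)) (α : Multiset ℂ), w.asIdeal.under (NumberField.RingOfIntegers K) = v.asIdeal → π.1.HasSatakeParamAt v α → (ρ₀.restrictField L).IsUnramifiedAt w ∧ (ρ₀.restrictField L).HasFrobCharpolyAt w (Literature.NumberTheory.Automorphic.arithFrobPolyOfSatake ι w.residueCard 1 (α.map (fun a => a ^ w.asIdeal.inertiaDeg (NumberField.RingOfIntegers K))))) → ∃ π' : Literature.NumberTheory.Automorphic.CuspidalAutomorphicRepData n K hcpt, π'.1.IsLAlgebraic ∧ ∀ᶠ v : IsDedekindDomain.HeightOneSpectrum (NumberField.RingOfIntegers K) in cofinite, SatakeFrobCompatibleAt ι π'.1 ρ₀ v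

/-- **ALR · «non-abelian Bauer» · purely automorphic · S-implied via (A) · lateral to RIGID · n = 1 PROVED (`alr_rankOne`) · INSTRUMENTABLE** —
automorphic layer rigidity: two L-algebraic cuspidal `π, π'` of `GL_n/K` with a common IRREDUCIBLE semisimple relative avatar
`r : Γ_L → GL_n(ℚ̄_ℓ)` along a Galois layer `L/K` without cyclic sub-layers of prime degree have the same Satake parameters at almost every place.
Why it might fail: a twin pair (`π ≇ π'` agreeing at `Spl(L/K)` with `{α^f} = {β^f}` elsewhere) in a regime without Galois representations
(Maass forms, non-regular `π`); the reducible near-twin `(τ, τ^σ)` of `A₅` shows irreducibility of `r` must enter any proof. -/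
def AutomorphicLayerRigidity : Prop :=
  ∀ (K : Type) [Field K] [NumberField K] (n : ℕ) (hcpt : Literature.NumberTheory.Automorphic.isCompact_glFiniteIntegralLevel n K), 0 < n → ∀ (π : Literature.NumberTheory.Automorphic.CuspidalAutomorphicRepData n K hcpt), π.1.IsLAlgebraic → ∀ (π' : Literature.NumberTheory.Automorphic.CuspidalAutomorphicRepData n K hcpt), π'.1.IsLAlgebraic → ∀ (L : Type) [Field L] [NumberField L] [Algebra K L], IsGalois K L → Module.finrank K L ≠ 1 → (¬ ∃ F : IntermediateField K L, F ≠ ⊥ ∧ IsGalois K ↥F ∧ IsCyclic (↥F ≃ₐ[K] ↥F) ∧ (Module.finrank K ↥F).Prime) → ∀ (ℓ : ℕ) [Fact ℓ.Prime] (ι : PadicAlgCl ℓ ≃+* ℂ) (r : Literature.NumberTheory.GaloisRepresentations.FramedGaloisRep L (PadicAlgCl ℓ) n), r.toGaloisRep.IsSemisimple → r.IsIrreducible → (∀ᶠ w : IsDedekindDomain.HeightOneSpectrum (NumberField.RingOfIntegers L) in cofinite, ∀ (v : IsDedekindDomain.HeightOneSpectrum (NumberField.RingOfIntegers K)) (α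 : Multiset ℂ), w.asIdeal.under (NumberField.RingOfIntegers K) = v.asIdeal → π.1.HasSatakeParamAt v α → r.IsUnramifiedAt w ∧ r.HasFrobCharpolyAt w (Literature.NumberTheory.Automorphic.arithFrobPolyOfSatake ι w.residueCard 1 (α.map (fun a => a ^ w.asIdeal.inertiaDeg (NumberField.RingOfIntegers K))))) → (∀ᶠ w : IsDedekindDomain.HeightOneSpectrum (NumberField.RingOfIntegers L) in cofinite, ∀ (v : IsDedekindDomain.HeightOneSpectrum (NumberField.RingOfIntegers K)) (α : Multiset ℂ), w.asIdeal.under (NumberField.RingOfIntegers K) = v.asIdeal → π'.1.HasSatakeParamAt v α → r.IsUnramifiedAt w ∧ r.HasFrobCharpolyAt w (Literature.NumberTheory.Automorphic.arithFrobPolyOfSatake ι w.residueCard 1 (α.map (fun a => a ^ w.asIdeal.inertiaDeg (NumberField.RingOfIntegers K))))) → ∀ᶠ v : IsDedekindDomain.HeightOneSpectrum (NumberField.RingOfIntegers K) in cofinite, ∀ (α β : Multiset ℂ), π.1.HasSatakeParamAt v α → π'.1.HasSatakeParamAt v β → α = β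

/-- ALR as a family in the rank `n` (node-local; `alr_iff_forall`), so that the PROVED rung `alr_rankOne : AutomorphicLayerRigidityAt 1` is a
literal slice. -/
def AutomorphicLayerRigidityAt (n : ℕ) : Prop :=
  ∀ (K : Type) [Field K] [NumberField K] (hcpt : Literature.NumberTheory.Automorphic.isCompact_glFiniteIntegralLevel n K), 0 < n → ∀ (π : Literature.NumberTheory.Automorphic.CuspidalAutomorphicRepData n K hcpt), π.1.IsLAlgebraic → ∀ (π' : Literature.NumberTheory.Automorphic.CuspidalAutomorphicRepData n K hcpt), π'.1.IsLAlgebraic → ∀ (L : Type) [Field L] [NumberField L] [Algebra K L], IsGalois K L → Module.finrank K L ≠ 1 → (¬ ∃ F : IntermediateField K L, F ≠ ⊥ ∧ IsGalois K ↥F ∧ IsCyclic (↥F ≃ₐ[K] ↥F) ∧ (Module.finrank K ↥F).Prime) → ∀ (ℓ : ℕ) [Fact ℓ.Prime] (ι : PadicAlgCl ℓ ≃+* ℂ) (r : Literature.NumberTheory.GaloisRepresentations.FramedGaloisRep L (PadicAlgCl ℓ) n), r.toGaloisRep.IsSemisimple → r.IsIrreducible → (∀ᶠ w : IsDedekindDomain.HeightOneSpectrum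 (NumberField.RingOfIntegers L) in cofinite, ∀ (v : IsDedekindDomain.HeightOneSpectrum (NumberField.RingOfIntegers K)) (α : Multiset ℂ), w.asIdeal.under (NumberField.RingOfIntegers K) = v.asIdeal → π.1.HasSatakeParamAt v α → r.IsUnramifiedAt w ∧ r.HasFrobCharpolyAt w (Literature.NumberTheory.Automorphic.arithFrobPolyOfSatake ι w.residueCard 1 (α.map (fun a => a ^ w.asIdeal.inertiaDeg (NumberField.RingOfIntegers K))))) → (∀ᶠ w : IsDedekindDomain.HeightOneSpectrum (NumberField.RingOfIntegers L) in cofinite, ∀ (v : IsDedekindDomain.HeightOneSpectrum (NumberField.RingOfIntegers K)) (α : Multiset ℂ), w.asIdeal.under (NumberField.RingOfIntegers K) = v.asIdeal → π'.1.HasSatakeParamAt v α → r.IsUnramifiedAt w ∧ r.HasFrobCharpolyAt w (Literature.NumberTheory.Automorphic.arithFrobPolyOfSatake ι w.residueCard 1 (α.map (fun a => a ^ w.asIdeal.inertiaDeg (NumberField.RingOfIntegers K))))) → ∀ᶠ v : IsDedekindDomain.HeightOneSpectrum (NumberField.RingOfIntegers K) in cofinite, ∀ (α β : Multiset ℂ),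 π.1.HasSatakeParamAt v α → π'.1.HasSatakeParamAt v β → α = β

/-- `AutomorphicLayerRigidity` is the conjunction of its rank slices. -/
theorem alr_iff_forall : AutomorphicLayerRigidity ↔ ∀ n, AutomorphicLayerRigidityAt n :=
  ⟨fun h n K _ _ => h K n, fun h K _ _ n => h n K⟩

/-! ## §1 The Galois shadow of ALR: uniqueness of extension across a layer without cyclic-prime sub-layers (0 sorry)
(g25 node-local lemmas `PerfectLayerClifford` §1, NOT in the tree — re-certified here — plus two new transfer lemmas.) -/

section Shadow

variable {K L : Type} [Field K] [NumberField K] [Field L] [NumberField L] [Algebra K L]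

/-- **No cyclic prime layer ⟹ no normal subgroup of prime index in `Gal(L/K)`** (the fixed field of a normal subgroup of prime index `p`
is Galois over `K`, cyclic of degree `p`). [folklore] -/
theorem no_normal_subgroup_of_prime_index [IsGalois K L]
    (hnc : ¬ ∃ F : IntermediateField K L, F ≠ ⊥ ∧ IsGalois K ↥F ∧ IsCyclic (↥F ≃ₐ[K] ↥F) ∧ (Module.finrank K ↥F).Prime)
    (N : Subgroup (L ≃ₐ[K] L)) [N.Normal] (hp : N.index.Prime) : False := by
  haveI : FiniteDimensional K L := Module.Finite.of_restrictScalars_finite ℚ K L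
  set F : IntermediateField K L := IntermediateField.fixedField N with hF
  haveI : IsGalois K ↥F := IsGalois.of_fixedField_normal_subgroup N
  have hcard : Nat.card (↥F ≃ₐ[K] ↥F) = N.index := by
    rw [Subgroup.index_eq_card]
    exact Nat.card_congr (IsGalois.normalAutEquivQuotient N).toEquiv.symm
  have hrank : Module.finrank K ↥F = N.index := by
    rw [← IsGalois.card_aut_eq_finrank K ↥F, hcard]
  haveI : Fact N.index.Prime := ⟨hp⟩
  have hcyc : IsCyclic (↥F ≃ₐ[K] ↥F) := isCyclic_of_prime_card hcard
  have hbot : F ≠ ⊥ := by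
    intro h
    have h1 : Module.finrank K ↥F = 1 := IntermediateField.finrank_eq_one_iff.mpr h
    rw [hrank] at h1
    exact hp.one_lt.ne' h1
  exact hnc ⟨F, hbot, inferInstance, hcyc, by rw [hrank]; exact hp⟩

/-- **No cyclic prime layer ⟹ `Gal(L/K)` has no non-trivial homomorphism to the units of a domain** (a non-trivial finite cyclic image
has a subgroup of prime index, whose preimage is normal of prime index).  So `Gal(L/K)` is perfect. [folklore] -/
theorem monoidHom_units_eq_one [IsGalois K L]
    (hnc : ¬ ∃ F : IntermediateField K L, F ≠ ⊥ ∧ IsGalois K ↥F ∧ IsCyclic (↥F ≃ₐ[K] ↥F) ∧ (Module.finrank K ↥F).Prime)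
    {A : Type*} [CommRing A] [IsDomain A] (χ : (L ≃ₐ[K] L) →* Aˣ) : χ = 1 := by
  haveI : FiniteDimensional K L := Module.Finite.of_restrictScalars_finite ℚ K L
  by_contra hχ
  obtain ⟨g, hg⟩ : ∃ g, χ g ≠ 1 := by
    by_contra h
    push Not at h
    exact hχ (MonoidHom.ext fun x => by rw [h x, MonoidHom.one_apply])
  set C : Subgroup Aˣ := χ.range with hC
  haveI : Finite C := Finite.of_surjective χ.rangeRestrict χ.rangeRestrict_surjective
  have hC1 : 1 < Nat.card C := by
    rw [Finite.one_lt_card_iff_nontrivial]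
    refine ⟨⟨⟨χ g, g, rfl⟩, 1, fun h => hg ?_⟩⟩
    exact congrArg Subtype.val h
  obtain ⟨p, hp, hpd⟩ := Nat.exists_prime_and_dvd hC1.ne'
  haveI : Fact p.Prime := ⟨hp⟩
  set D : Subgroup C := (powMonoidHom p : C →* C).range with hD
  have hDi : D.index = p := by
    rw [hD, IsCyclic.index_powMonoidHom_range, Nat.gcd_eq_right hpd]
  set N : Subgroup (L ≃ₐ[K] L) := D.comap χ.rangeRestrict with hN
  haveI : N.Normal := Subgroup.Normal.comap inferInstance _
  have hNi : N.index = p := by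
    rw [hN, D.index_comap_of_surjective χ.rangeRestrict_surjective, hDi]
  exact no_normal_subgroup_of_prime_index hnc N (hNi ▸ hp)

/-- **No cyclic prime layer ⟹ a continuous character of `Γ_K` that is trivial on `Γ_L` is trivial** (factor through `Γ_K ↠ Gal(L/K)` with the
tree's `absGaloisQuot`, `absGaloisQuot_eq_one_iff`; then `monoidHom_units_eq_one`).  This is the `n = 1` heart of ALR. [folklore] -/
theorem character_eq_one_of_trivial_on_layer [IsGalois K L]
    (hnc : ¬ ∃ F : IntermediateField K L, F ≠ ⊥ ∧ IsGalois K ↥F ∧ IsCyclic (↥F ≃ₐ[K] ↥F) ∧ (Module.finrank K ↥F).Prime)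
    {A : Type*} [Field A] [TopologicalSpace A] [IsTopologicalRing A]
    (χ : Field.absoluteGaloisGroup K →ₜ* Aˣ) (hχ : ∀ σ : Field.absoluteGaloisGroup L, χ (absGaloisRestrict K L σ) = 1) :
    χ = 1 := by
  haveI : FiniteDimensional K L := Module.Finite.of_restrictScalars_finite ℚ K L
  have hker : (absGaloisQuot K L).ker ≤ (χ : Field.absoluteGaloisGroup K →* Aˣ).ker := by
    intro τ hτ
    rw [MonoidHom.mem_ker] at hτ ⊢
    obtain ⟨σ, rfl⟩ := (absGaloisQuot_eq_one_iff K L τ).1 hτ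
    exact hχ σ
  set χbar : (L ≃ₐ[K] L) →* Aˣ :=
    (absGaloisQuot K L).liftOfSurjective (absGaloisQuot_surjective K L) ⟨(χ : Field.absoluteGaloisGroup K →* Aˣ), hker⟩ with hχbar
  have hfac : ∀ τ, χbar (absGaloisQuot K L τ) = χ τ := fun τ => by
    rw [hχbar]
    exact MonoidHom.liftOfRightInverse_comp_apply _ _ _ _ τ
  have h1 : χbar = 1 := monoidHom_units_eq_one hnc χbar
  refine ContinuousMonoidHom.ext fun τ => ?_
  have := hfac τ
  rw [h1, MonoidHom.one_apply] at this
  rw [← this]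
  rfl

variable {ℓ : ℕ} [Fact ℓ.Prime] {n : ℕ}

/-- **Uniqueness of extension**: if `ρ|Γ_L`, `ρ₀|Γ_L` are conjugate and irreducible then `ρ`, `ρ₀` are conjugate — by Clifford theory (tree
`exists_twist_of_conj_restrictField`) `ρ = P (ρ₀ ⊗ χ) P⁻¹` for a character `χ` of `Gal(L/K)`, and there is none but `1`. [Clifford 1937; folklore] -/
theorem conj_of_conj_restrictField [IsGalois K L]
    (hnc : ¬ ∃ F : IntermediateField K L, F ≠ ⊥ ∧ IsGalois K ↥F ∧ IsCyclic (↥F ≃ₐ[K] ↥F) ∧ (Module.finrank K ↥F).Prime)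
    (ρ ρ₀ : FramedGaloisRep K (PadicAlgCl ℓ) n) (hirr : (ρ₀.restrictField L).IsIrreducible)
    (hconj : ∃ P : GL (Fin n) (PadicAlgCl ℓ), FramedRep.conj P (ρ.restrictField L) = ρ₀.restrictField L) :
    ∃ P : GL (Fin n) (PadicAlgCl ℓ), FramedRep.conj P ρ = ρ₀ := by
  obtain ⟨χ, P, hχ, h⟩ := FramedGaloisRep.exists_twist_of_conj_restrictField ρ ρ₀ hirr hconj
  have h1 : χ = 1 := character_eq_one_of_trivial_on_layer hnc χ hχ
  exact ⟨P, by rw [h, h1, FramedRep.twist_one]⟩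

/-- … **from Frobenius data on the layer**: semisimple `ρ, ρ₀` over `K` whose restrictions (with `ρ₀|Γ_L` irreducible) have the same Frobenius
polynomials at almost all places of `L` are conjugate (Chebotarev + Brauer–Nesbitt over `L`: tree `nonempty_equiv_of_hasFrobCharpolyAt_eventually`
with the PROVED `chebotarev_artinRep_holds`; then `conj_of_conj_restrictField`). [folklore] -/
theorem conj_of_frobenius_on_layer [IsGalois K L]
    (hnc : ¬ ∃ F : IntermediateField K L, F ≠ ⊥ ∧ IsGalois K ↥F ∧ IsCyclic (↥F ≃ₐ[K] ↥F) ∧ (Module.finrank K ↥F).Prime)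
    (ρ ρ₀ : FramedGaloisRep K (PadicAlgCl ℓ) n) (hρ : ρ.toGaloisRep.IsSemisimple) (hρ₀ : ρ₀.toGaloisRep.IsSemisimple)
    (hirr : (ρ₀.restrictField L).IsIrreducible)
    (h : ∀ᶠ w : HeightOneSpectrum (𝓞 L) in cofinite, (ρ.restrictField L).IsUnramifiedAt w ∧ (ρ₀.restrictField L).IsUnramifiedAt w ∧
        ∃ P : (PadicAlgCl ℓ)[X], (ρ.restrictField L).HasFrobCharpolyAt w P ∧ (ρ₀.restrictField L).HasFrobCharpolyAt w P) :
    ∃ P : GL (Fin n) (PadicAlgCl ℓ), FramedRep.conj P ρ = ρ₀ := by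
  obtain ⟨e⟩ := FramedGaloisRep.nonempty_equiv_of_hasFrobCharpolyAt_eventually chebotarev_artinRep_holds
    (ρ.restrictField L) (ρ₀.restrictField L) (ρ.isSemisimple_restrictField hρ) (ρ₀.isSemisimple_restrictField hρ₀) h
  obtain ⟨P, hP⟩ := FramedRep.exists_eq_conj_of_equiv _ _ e
  exact conj_of_conj_restrictField hnc ρ ρ₀ hirr ⟨P, hP.symm⟩

variable {hK : isCompact_glFiniteIntegralLevel n K}

/-- Satake–Frobenius compatibility is invariant under change of frame. [folklore] -/
theorem satakeFrobCompatibleAt_conj_iff (π : AutomorphicRepData (AutomorphyDatum.gl n K hK)) (ι : PadicAlgCl ℓ ≃+* ℂ)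
    (P : GL (Fin n) (PadicAlgCl ℓ)) (ρ : FramedGaloisRep K (PadicAlgCl ℓ) n) (v : HeightOneSpectrum (𝓞 K)) :
    SatakeFrobCompatibleAt ι π (FramedRep.conj P ρ) v ↔ SatakeFrobCompatibleAt ι π ρ v := by
  simp only [SatakeFrobCompatibleAt, FramedGaloisRep.isUnramifiedAt_conj_iff, hasFrobCharpolyAt_conj_iff']

/-- Irreducibility passes from a semisimple irreducible relative avatar `r` to the restriction of any semisimple candidate `ρ₀` carrying the
same relative avatar (`r ≅ ρ₀|Γ_L` by Chebotarev–Brauer–Nesbitt over `L`). [folklore] -/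
theorem isIrreducible_restrictField_of_relAvatar [IsGalois K L] (π : AutomorphicRepData (AutomorphyDatum.gl n K hK))
    (ι : PadicAlgCl ℓ ≃+* ℂ)
    (r : FramedGaloisRep L (PadicAlgCl ℓ) n) (hr : r.toGaloisRep.IsSemisimple) (hirr : r.IsIrreducible)
    (hrel : (∀ᶠ w : HeightOneSpectrum (𝓞 L) in cofinite, ∀ (v : HeightOneSpectrum (𝓞 K)) (α : Multiset ℂ),
      w.asIdeal.under (𝓞 K) = v.asIdeal → π.HasSatakeParamAt v α →
        r.IsUnramifiedAt w ∧ r.HasFrobCharpolyAt w (arithFrobPolyOfSatake ι w.residueCard 1 (α.map (fun a => a ^ w.asIdeal.inertiaDeg (𝓞 K))))))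
    (ρ₀ : FramedGaloisRep K (PadicAlgCl ℓ) n) (hρ₀ : ρ₀.toGaloisRep.IsSemisimple)
    (h₀ : (∀ᶠ w : HeightOneSpectrum (𝓞 L) in cofinite, ∀ (v : HeightOneSpectrum (𝓞 K)) (α : Multiset ℂ),
      w.asIdeal.under (𝓞 K) = v.asIdeal → π.HasSatakeParamAt v α →
        (ρ₀.restrictField L).IsUnramifiedAt w ∧ (ρ₀.restrictField L).HasFrobCharpolyAt w (arithFrobPolyOfSatake ι w.residueCard 1 (α.map (fun a => a ^ w.asIdeal.inertiaDeg (𝓞 K)))))) :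
    (ρ₀.restrictField L).IsIrreducible := by
  obtain ⟨e⟩ := FramedGaloisRep.nonempty_equiv_of_hasFrobCharpolyAt_eventually chebotarev_artinRep_holds
    r (ρ₀.restrictField L) hr (ρ₀.isSemisimple_restrictField hρ₀) (frobenius_agree_of_relAvatar π ι r _ hrel h₀)
  haveI : r.toGaloisRep.toRepresentation.IsIrreducible := hirr
  exact Literature.RepresentationTheory.Semisimple.Representation.isIrreducible_of_equiv e.toRepEquiv

/-- **THE CANDIDATE IS UNIQUE.**  Along a layer without cyclic-prime sub-layers: if `r` is an irreducible semisimple relative avatar of `π`,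
`ρ₀` a semisimple candidate carrying it, and `ρ` semisimple over `K` is Satake–Frobenius compatible with `π` a.e., then `ρ` is CONJUGATE to `ρ₀`.
[Clifford 1937 + Chebotarev + Brauer–Nesbitt; folklore] -/
theorem candidate_unique [IsGalois K L]
    (hnc : ¬ ∃ F : IntermediateField K L, F ≠ ⊥ ∧ IsGalois K ↥F ∧ IsCyclic (↥F ≃ₐ[K] ↥F) ∧ (Module.finrank K ↥F).Prime)
    (π : AutomorphicRepData (AutomorphyDatum.gl n K hK)) (ι : PadicAlgCl ℓ ≃+* ℂ)
    (r : FramedGaloisRep L (PadicAlgCl ℓ) n) (hr : r.toGaloisRep.IsSemisimple) (hirr : r.IsIrreducible)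
    (hrel : (∀ᶠ w : HeightOneSpectrum (𝓞 L) in cofinite, ∀ (v : HeightOneSpectrum (𝓞 K)) (α : Multiset ℂ),
      w.asIdeal.under (𝓞 K) = v.asIdeal → π.HasSatakeParamAt v α →
        r.IsUnramifiedAt w ∧ r.HasFrobCharpolyAt w (arithFrobPolyOfSatake ι w.residueCard 1 (α.map (fun a => a ^ w.asIdeal.inertiaDeg (𝓞 K))))))
    (ρ₀ : FramedGaloisRep K (PadicAlgCl ℓ) n) (hρ₀ : ρ₀.toGaloisRep.IsSemisimple)
    (h₀ : (∀ᶠ w : HeightOneSpectrum (𝓞 L) in cofinite, ∀ (v : HeightOneSpectrum (𝓞 K)) (α : Multiset ℂ),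
      w.asIdeal.under (𝓞 K) = v.asIdeal → π.HasSatakeParamAt v α →
        (ρ₀.restrictField L).IsUnramifiedAt w ∧ (ρ₀.restrictField L).HasFrobCharpolyAt w (arithFrobPolyOfSatake ι w.residueCard 1 (α.map (fun a => a ^ w.asIdeal.inertiaDeg (𝓞 K))))))
    (ρ : FramedGaloisRep K (PadicAlgCl ℓ) n) (hρ : ρ.toGaloisRep.IsSemisimple)
    (hc : ∀ᶠ v : HeightOneSpectrum (𝓞 K) in cofinite, SatakeFrobCompatibleAt ι π ρ v) :
    ∃ P : GL (Fin n) (PadicAlgCl ℓ), FramedRep.conj P ρ = ρ₀ :=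
  conj_of_frobenius_on_layer hnc ρ ρ₀ hρ hρ₀ (isIrreducible_restrictField_of_relAvatar π ι r hr hirr hrel ρ₀ hρ₀ h₀)
    (frobenius_agree_of_relAvatar π ι _ _ (relAvatar_restrictField_of_compatible π ι ρ hc) h₀)

/-- **TRANSFER OF THE RELATIVE-AVATAR CONDITION between representations with a common companion** (new): if `s` is a relative avatar of BOTH `π`
and `π'` along `L/K` and `r` is a relative avatar of `π`, then `r` is a relative avatar of `π'` — at a.e. `w` the Frobenius polynomial of `s`
is unique (tree `GaloisRep.HasFrobCharpolyAt.unique_holds`), so the Satake polynomials of `π` and `π'` pulled back to `w` coincide. [folklore] -/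
theorem relAvatar_transfer (π π' : AutomorphicRepData (AutomorphyDatum.gl n K hK)) (ι : PadicAlgCl ℓ ≃+* ℂ)
    (r s : FramedGaloisRep L (PadicAlgCl ℓ) n)
    (hs : (∀ᶠ w : HeightOneSpectrum (𝓞 L) in cofinite, ∀ (v : HeightOneSpectrum (𝓞 K)) (α : Multiset ℂ),
      w.asIdeal.under (𝓞 K) = v.asIdeal → π.HasSatakeParamAt v α →
        s.IsUnramifiedAt w ∧ s.HasFrobCharpolyAt w (arithFrobPolyOfSatake ι w.residueCard 1 (α.map (fun a => a ^ w.asIdeal.inertiaDeg (𝓞 K))))))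
    (hr : (∀ᶠ w : HeightOneSpectrum (𝓞 L) in cofinite, ∀ (v : HeightOneSpectrum (𝓞 K)) (α : Multiset ℂ),
      w.asIdeal.under (𝓞 K) = v.asIdeal → π.HasSatakeParamAt v α →
        r.IsUnramifiedAt w ∧ r.HasFrobCharpolyAt w (arithFrobPolyOfSatake ι w.residueCard 1 (α.map (fun a => a ^ w.asIdeal.inertiaDeg (𝓞 K))))))
    (hs' : (∀ᶠ w : HeightOneSpectrum (𝓞 L) in cofinite, ∀ (v : HeightOneSpectrum (𝓞 K)) (β : Multiset ℂ),
      w.asIdeal.under (𝓞 K) = v.asIdeal → π'.HasSatakeParamAt v β →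
        s.IsUnramifiedAt w ∧ s.HasFrobCharpolyAt w (arithFrobPolyOfSatake ι w.residueCard 1 (β.map (fun a => a ^ w.asIdeal.inertiaDeg (𝓞 K)))))) :
    ∀ᶠ w : HeightOneSpectrum (𝓞 L) in cofinite, ∀ (v : HeightOneSpectrum (𝓞 K)) (β : Multiset ℂ),
      w.asIdeal.under (𝓞 K) = v.asIdeal → π'.HasSatakeParamAt v β →
        r.IsUnramifiedAt w ∧ r.HasFrobCharpolyAt w (arithFrobPolyOfSatake ι w.residueCard 1 (β.map (fun a => a ^ w.asIdeal.inertiaDeg (𝓞 K)))) := by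
  filter_upwards [hs, hr, hs', eventually_under (F := K) (E := L) (AutomorphicRepData.hasSatakeParamAt_cofinite_holds π)]
    with w hws hwr hws' hS
  intro v β hv hβ
  obtain ⟨α, hα⟩ := hS v hv
  obtain ⟨hur, hch⟩ := hwr v α hv hα
  have heq := GaloisRep.HasFrobCharpolyAt.unique_holds
    ((FramedGaloisRep.hasFrobCharpolyAt_toGaloisRep_iff w _ s).2 (hws v α hv hα).2)
    ((FramedGaloisRep.hasFrobCharpolyAt_toGaloisRep_iff w _ s).2 (hws' v β hv hβ).2)
  refine ⟨hur, ?_⟩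
  rw [← heq]
  exact hch

/-- **EQUAL SATAKE PARAMETERS FROM CONJUGATE AVATARS** (new): if `ρ' = P ρ P⁻¹` and `ρ`, `ρ'` are a.e. Satake–Frobenius compatible with `π`, `π'`
respectively, then `π` and `π'` have the same Satake parameters a.e. (Frobenius polynomials are frame-invariant and unique; the Satake-to-Frobenius
dictionary is injective, tree `arithFrobPolyOfSatake_injective`; Satake parameters are unique, tree `hasSatakeParamAt_unique_holds`). [folklore] -/
theorem satake_eq_of_compatible_conj (π π' : AutomorphicRepData (AutomorphyDatum.gl n K hK)) (ι : PadicAlgCl ℓ ≃+* ℂ)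
    (ρ ρ' : FramedGaloisRep K (PadicAlgCl ℓ) n) (P : GL (Fin n) (PadicAlgCl ℓ)) (hP : FramedRep.conj P ρ = ρ')
    (hc : ∀ᶠ v : HeightOneSpectrum (𝓞 K) in cofinite, SatakeFrobCompatibleAt ι π ρ v)
    (hc' : ∀ᶠ v : HeightOneSpectrum (𝓞 K) in cofinite, SatakeFrobCompatibleAt ι π' ρ' v) :
    ∀ᶠ v : HeightOneSpectrum (𝓞 K) in cofinite, ∀ (α β : Multiset ℂ), π.HasSatakeParamAt v α → π'.HasSatakeParamAt v β → α = β := by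
  subst hP
  filter_upwards [hc, hc'] with v hv hv'
  intro α β hα hβ
  obtain ⟨α₀, hα₀, -, hchα⟩ := hv
  obtain ⟨β₀, hβ₀, -, hchβ⟩ := hv'
  have e₁ : α₀ = α := π.hasSatakeParamAt_unique_holds hα₀ hα
  have e₂ : β₀ = β := π'.hasSatakeParamAt_unique_holds hβ₀ hβ
  subst e₁ e₂
  have h2 := (hasFrobCharpolyAt_conj_iff' v _ P ρ).1 hchβ
  have heq := GaloisRep.HasFrobCharpolyAt.unique_holds
    ((FramedGaloisRep.hasFrobCharpolyAt_toGaloisRep_iff v _ ρ).2 hchα) ((FramedGaloisRep.hasFrobCharpolyAt_toGaloisRep_iff v _ ρ).2 h2)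
  exact arithFrobPolyOfSatake_injective ι (zero_lt_one.trans v.one_lt_residueCard) 1 heq

/-- **ALR, POINTWISE, FOR A PAIR WITH AVATARS (PROVED CELL).**  If `π` and `π'` both admit a.e.-compatible semisimple `ℓ`-adic avatars
`ρ, ρ'` over `K`, the conclusion of ALR holds for them: `ρ|Γ_L ≅ r ≅ ρ'|Γ_L` is irreducible, so `ρ' = P ρ P⁻¹` (`conj_of_frobenius_on_layer`)
and the Satake parameters coincide a.e. (`satake_eq_of_compatible_conj`).  This is the whole Galois-side content of ALR; what is OPEN is
only the case where `π` or `π'` has no avatar. [folklore assembly] -/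
theorem alr_pointwise_of_avatars [IsGalois K L]
    (hnc : ¬ ∃ F : IntermediateField K L, F ≠ ⊥ ∧ IsGalois K ↥F ∧ IsCyclic (↥F ≃ₐ[K] ↥F) ∧ (Module.finrank K ↥F).Prime)
    (π π' : AutomorphicRepData (AutomorphyDatum.gl n K hK)) (ι : PadicAlgCl ℓ ≃+* ℂ)
    (r : FramedGaloisRep L (PadicAlgCl ℓ) n) (hr : r.toGaloisRep.IsSemisimple) (hirr : r.IsIrreducible)
    (hrel : (∀ᶠ w : HeightOneSpectrum (𝓞 L) in cofinite, ∀ (v : HeightOneSpectrum (𝓞 K)) (α : Multiset ℂ),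
      w.asIdeal.under (𝓞 K) = v.asIdeal → π.HasSatakeParamAt v α →
        r.IsUnramifiedAt w ∧ r.HasFrobCharpolyAt w (arithFrobPolyOfSatake ι w.residueCard 1 (α.map (fun a => a ^ w.asIdeal.inertiaDeg (𝓞 K))))))
    (hrel' : (∀ᶠ w : HeightOneSpectrum (𝓞 L) in cofinite, ∀ (v : HeightOneSpectrum (𝓞 K)) (β : Multiset ℂ),
      w.asIdeal.under (𝓞 K) = v.asIdeal → π'.HasSatakeParamAt v β →
        r.IsUnramifiedAt w ∧ r.HasFrobCharpolyAt w (arithFrobPolyOfSatake ι w.residueCard 1 (β.map (fun a => a ^ w.asIdeal.inertiaDeg (𝓞 K))))))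
    (ρ : FramedGaloisRep K (PadicAlgCl ℓ) n) (hρ : ρ.toGaloisRep.IsSemisimple)
    (hc : ∀ᶠ v : HeightOneSpectrum (𝓞 K) in cofinite, SatakeFrobCompatibleAt ι π ρ v)
    (ρ' : FramedGaloisRep K (PadicAlgCl ℓ) n) (hρ' : ρ'.toGaloisRep.IsSemisimple)
    (hc' : ∀ᶠ v : HeightOneSpectrum (𝓞 K) in cofinite, SatakeFrobCompatibleAt ι π' ρ' v) :
    ∀ᶠ v : HeightOneSpectrum (𝓞 K) in cofinite, ∀ (α β : Multiset ℂ), π.HasSatakeParamAt v α → π'.HasSatakeParamAt v β → α = β := by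
  have h₀ := relAvatar_restrictField_of_compatible (L := L) π ι ρ hc
  have h₀' := relAvatar_restrictField_of_compatible (L := L) π' ι ρ' hc'
  have h₁ := relAvatar_transfer π' π ι (ρ'.restrictField L) r hrel' h₀' hrel
  obtain ⟨P, hP⟩ := conj_of_frobenius_on_layer hnc ρ ρ' hρ hρ'
    (isIrreducible_restrictField_of_relAvatar π ι r hr hirr hrel ρ' hρ' h₁) (frobenius_agree_of_relAvatar π ι _ _ h₀ h₁)
  exact satake_eq_of_compatible_conj π π' ι ρ ρ' P hP hc hc'

end Shadow

end Summit.Langlands.Langlands.Theorems.TwinRigiditySplit
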